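import Summits.QuantumFields.YangMills.Theorems.BalabanUVNodesN14ConvexFibreBox
import Summits.QuantumFields.YangMills.Theorems.FluctuationComparisonRegPrIntLTailSupOneConvexTail
import Summits.QuantumFields.BalabanUV.T4Continuum.Spine.NE7b.StrongConvexSubgradientField
import HarnessLib

/-!
# `FluctuationComparisonRegPrIntLTailSupOneConvexTailBox` — LINE g21-2 «DEPTH-ONE WINDOW ODDS BY A MEASURE SPLIT»: THE CONVEX-DOMAIN ∕ CONVEX-SET
# EDITION OF THE NON-GAUSSIAN ENGINE OF MOD₁ (window odds from uniform convexity of the fibre action ON A CONVEX CHART DOMAIN)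
# (crux `UnitScaleTilt.FluctuationComparisonRegPrIntL`, stmt-QuantumFields-20520; row MOD₁ `ModerateFieldOddsDepthOneCan` of `Cruxes/…/Lines/tailsup_one.lean`,
# ideator ym-r3-idea-1 g21; engines = Track A's ✓`YMDAG.N14.ConvexFibreBox.hasSubgaussianMGF_box_of_uniformlyConvexOn` ∕
# ✓`…hasSubgaussianMGF_convexSet_of_uniformlyConvex` ∕ ✓`…hasSubgaussianMGF_of_hasEntropyExpC1c` — Bobkov–Ledoux ∘ Herbst, PROVED in the tree)

Cell `ym3-torus` (YM ladder rung R3 = continuum SU(2) Yang–Mills on T³ — a RUNG, NOT the Clay problem: not d = 4, not infinite volume, not a mass gap);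
width seat `ym3-torus-px20` (gen 10); helper `--supports stmt-QuantumFields-20520`.  THEOREMS ONLY (0 `def`, 0 `sorry`, default heartbeats).

WHY.  The whole-space edition (`…TailSupOneConvexTail`, w3-20520 g17: `ν = e^{−V}dx∕Z` on `ℝⁿ`, `V` `λ`-uniformly convex ⇒ the max-tail of a finite
family of `C¹` observables with gradient `≤ L` is `≤ 2·#s·exp(−λt²∕(2L²))`, DIMENSION-FREE) asks the fibre action to be convex on ALL of `ℝⁿ`.  MOD₁'s obligation
(i) CHART presents the MODERATE region of the one-step constrained fibre — the event `{all fine plaquettes < δ₀}` — as a law on a BOUNDED chart domain, i.e. the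
realistic letter is the BOX law `1_Ω e^{−V}dz ∕ Z_Ω` with `V` convex ON `Ω` only (Track A's own reading of Bałaban's small-field fibres: «CONSTRAINED TO A BOX»,
`…N14ConvexFibreBox`), or a whole-space convex law CONDITIONED on a convex set («the `{< δ₀}`-restriction of a log-concave law to a convex set stays log-concave»).
Bobkov–Ledoux's convex-domain Bakry–Émery inequality (Prop. 3.1 and the remark p. 1038, both PROVED in the tree by node00-def-RR-2 and consumed by Track A's
box engine) gives the SAME sub-Gaussian constant `L²∕λ` with NO boundary loss; this file is the whole-space edition re-typed in that letter, constants unchanged.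
* §1 ★`convex_maxTail_of_hasEntropyExpC1c` — SCHEMA level: any probability law `ν` on `ℝⁿ` with the exponential entropy schema `HasEntropyExpC1c ν C`
  (`C > 0`) and bounded `C¹` observables with `‖DG_p‖ ≤ L`: `≤ 2·#s·exp(−t²∕(2CL²))`.
* §2 BOX ★★`convex_maxTail_box` ∕ ★`convex_maxTail_box_coupling_cancels` ∕ ★`convex_maxTail_box_of_centred` — `Ω` open convex with `volume Ω ≠ 0`, `V` continuous
  and `λ`-convex ON `Ω` (first-order letter with any field `W`), `e^{−V}` integrable on `Ω`: under `ν_Ω = (volume.restrict Ω).tilted (−V)` the three bounds of the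
  whole-space edition VERBATIM (`2·#s·exp(−λt²∕(2L²))`; `λ = m∕g²`, thresholds `g·t` ⇒ `exp(−m t²∕(2L²))`; means `≤ g·t∕2` ⇒ uncentred `exp(−m t²∕(8L²))`).
* §3 CONVEX SET ★`convex_maxTail_convexSet` ∕ ★`convex_maxTail_convexSet_of_centred` — whole-space `λ`-convex `V` conditioned on any convex `Bx` with `volume Bx ≠ 0`.
* §4 PROFILE ★`convexWindowOdds_box_le` ∕ ★`convexWindowOdds_convexSet_le` — thresholds `θBal L γ b₀ p₀ i = g_i·p(g_i)`: `≤ 2·#s·exp(−(m∕4)·pFun b₀ p₀ g_i²∕(2L²))`,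
  the shape of ✓`…TailSupOneGaussianTail.gaussianWindowOdds_le` at `m ↦ m∕4`, `R² ↦ L²`, so its level sums ∕ super-polynomial modulus apply BY NAME.
* §5 `StrongConvexOn` CURRENCY ★`convex_maxTail_box_of_strongConvexOn` ∕ ★`convexWindowOdds_box_le_of_strongConvexOn` — the box edition with Mathlib's
  `StrongConvexOn Ω m V` + `ContinuousOn V Ω` in place of the first-order letter (NO differentiability of `V`: the field is NE7b's strong-subgradient selection
  ✓`…StrongConvexSubgradientField.exists_firstOrderOn_field_of_strongConvexOn`) — the currency in which the tree's torus actions are typed.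
HONEST SCOPE.  Abstract concentration corollaries over PROVED tree engines; MOD₁'s obligations (chart, convexity of the fibre action on the chart domain uniformly in
the window datum, centring∕gradient of the plaquette observables) are NOT touched; MOD₁, FAR₁, TAILSUP₁, LFR♯ᶜ, S2β, 20520, `YM3TorusSU2` NOT proved; the Yang–Mills
mass gap is NOT proved.
References: [BobkovLedoux2000] Prop. 3.1 p. 1034, remark p. 1038; [BakryGentilLedoux2014] Prop. 5.4.1 (Herbst); [Balaban1985UV3] (7) p. 257, (38)–(41) p. 266;
[BoucheronLugosiMassart2013] §2.5.
-/

noncomputable section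

set_option autoImplicit false

open MeasureTheory ProbabilityTheory Filter Topology Set
open scoped RealInnerProductSpace ENNReal NNReal BigOperators
open Literature.MathematicalPhysics.QuantumFieldTheory.Balaban1983to89
open Literature.MathematicalPhysics.QuantumFieldTheory.Balaban1983to89.T3ContinuumYM3Torus
open Literature.MathematicalPhysics.QuantumFieldTheory.Balaban1983to89.T3UnitScaleTilt
open Literature.Analysis.FunctionSpaces (HasEntropyExpC1c isProbabilityMeasure_tilted_neg)
open YMDAG.N14.ConvexFibreBox (hasSubgaussianMGF_of_hasEntropyExpC1c isProbabilityMeasure_restrict_tilted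
  hasSubgaussianMGF_box_of_uniformlyConvexOn hasSubgaussianMGF_convexSet_of_uniformlyConvex)
open Summit.QuantumFields.YangMills.Theorems.FluctuationComparisonRegPrIntLTailSupOneConvexTail (maxTail_of_hasSubgaussianMGF)
open Summit.QuantumFields.BalabanUV.T4Continuum.NE7b.StrongConvexSubgradientField (exists_firstOrderOn_field_of_strongConvexOn)

namespace Summit.QuantumFields.YangMills.Theorems.FluctuationComparisonRegPrIntLTailSupOneConvexTailBox

variable {n : ℕ}

/-! ## §1 Schema level: any law on `ℝⁿ` with the exponential entropy schema `HasEntropyExpC1c ν C` -/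

section Schema

variable {ν : Measure (EuclideanSpace ℝ (Fin n))} [IsProbabilityMeasure ν] {C : ℝ}

/-- ★ **MAX-TAIL UNDER THE ENTROPY SCHEMA**: a probability law `ν` on `ℝⁿ` with `HasEntropyExpC1c ν C` (`C > 0`; node00-def-RR-2's schema, satisfied with
`C = 1∕λ` by `λ`-uniformly log-concave laws on the whole space, on a convex box, or conditioned on a convex set) and bounded `C¹` observables `G_p` with
`‖DG_p‖ ≤ L` (`L > 0`): `ν.real {x | ∃ p ∈ s, t ≤ |G_p x − ∫G_p dν|} ≤ 2·#s·exp(−t²∕(2·C·L²))` — ✓`hasSubgaussianMGF_of_hasEntropyExpC1c` (glue + Herbst) and ✓F's §0 `maxTail_of_hasSubgaussianMGF`.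
[cite: BakryGentilLedoux2014, Prop. 5.4.1; BoucheronLugosiMassart2013, §2.5] -/
theorem convex_maxTail_of_hasEntropyExpC1c (h : HasEntropyExpC1c ν C) (hC : 0 < C)
    {A : Type*} (s : Finset A) (G : A → EuclideanSpace ℝ (Fin n) → ℝ) (B : A → ℝ) {L : ℝ} (hL : 0 < L)
    (hG : ∀ p ∈ s, ContDiff ℝ 1 (G p)) (hGb : ∀ p ∈ s, ∀ x, |G p x| ≤ B p) (hGD : ∀ p ∈ s, ∀ x, ‖fderiv ℝ (G p) x‖ ≤ L)
    {t : ℝ} (ht : 0 ≤ t) :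
    ν.real {x | ∃ p ∈ s, t ≤ |G p x - ∫ z, G p z ∂ν|} ≤ 2 * s.card * Real.exp (-(t ^ 2 / (2 * (C * L ^ 2)))) := by
  set v : ℝ≥0 := ⟨C * L ^ 2, by positivity⟩
  have hsg : ∀ p ∈ s, HasSubgaussianMGF (fun x => G p x - ∫ z, G p z ∂ν) v ν := fun p hp =>
    hasSubgaussianMGF_of_hasEntropyExpC1c h hC (hG p hp) (hGb p hp) (hGD p hp) hL
  have h0 := maxTail_of_hasSubgaussianMGF ν s (fun p x => G p x - ∫ z, G p z ∂ν) v hsg ht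
  have hexp : 2 * (s.card : ℝ) * Real.exp (-t ^ 2 / (2 * (v : ℝ))) = 2 * s.card * Real.exp (-(t ^ 2 / (2 * (C * L ^ 2)))) := by
    rw [show (v : ℝ) = C * L ^ 2 from rfl]
    congr 2
    ring
  exact h0.trans hexp.le

end Schema

/-! ## §2 The box law: `1_Ω e^{−V}dx ∕ Z_Ω`, `V` convex on the open convex box `Ω` only -/

section Box

variable {Ωs : Set (EuclideanSpace ℝ (Fin n))} {V : EuclideanSpace ℝ (Fin n) → ℝ} {W : EuclideanSpace ℝ (Fin n) → EuclideanSpace ℝ (Fin n)}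
  {lam : ℝ}

/-- ★★ **DIMENSION-FREE MAX-TAIL UNDER A BOX LAW WITH AN ACTION CONVEX ON THE BOX**: `Ω` open and convex with `volume Ω ≠ 0`; `V` continuous on `Ω` and
`λ`-uniformly convex ON `Ω` in the first-order letter (any field `W`); `e^{−V}` integrable on `Ω`; `G_p` (`p ∈ s`) bounded `C¹` observables with `‖DG_p‖ ≤ L`
(`L > 0`); `t ≥ 0`.  Then under `ν_Ω = (volume.restrict Ω).tilted (−V)`:
`ν_Ω.real {x | ∃ p ∈ s, t ≤ |G_p x − ∫G_p dν_Ω|} ≤ 2·#s·exp(−λ·t²∕(2L²))` — the whole-space constant, no boundary loss (✓`hasSubgaussianMGF_box_of_uniformlyConvexOn`: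
Bobkov–Ledoux Prop. 3.1 ∘ Herbst, PROVED in the tree; then ✓F's §0). [cite: BobkovLedoux2000, Prop. 3.1 p. 1034; BakryGentilLedoux2014, Prop. 5.4.1] -/
theorem convex_maxTail_box (hΩo : IsOpen Ωs) (hΩc : Convex ℝ Ωs) (hΩ0 : volume Ωs ≠ 0) (hlam : 0 < lam)
    (hVc : ContinuousOn V Ωs) (hV : ∀ x ∈ Ωs, ∀ y ∈ Ωs, V x + ⟪W x, y - x⟫ + lam / 2 * ‖y - x‖ ^ 2 ≤ V y)
    (hZ : IntegrableOn (fun x => Real.exp (-V x)) Ωs)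
    {A : Type*} (s : Finset A) (G : A → EuclideanSpace ℝ (Fin n) → ℝ) (B : A → ℝ) {L : ℝ} (hL : 0 < L)
    (hG : ∀ p ∈ s, ContDiff ℝ 1 (G p)) (hGb : ∀ p ∈ s, ∀ x, |G p x| ≤ B p) (hGD : ∀ p ∈ s, ∀ x, ‖fderiv ℝ (G p) x‖ ≤ L)
    {t : ℝ} (ht : 0 ≤ t) :
    ((volume.restrict Ωs).tilted fun x => -V x).real
        {x | ∃ p ∈ s, t ≤ |G p x - ∫ z, G p z ∂((volume.restrict Ωs).tilted fun x => -V x)|} ≤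
      2 * s.card * Real.exp (-(lam * t ^ 2 / (2 * L ^ 2))) := by
  set ν : Measure (EuclideanSpace ℝ (Fin n)) := (volume.restrict Ωs).tilted fun x => -V x
  haveI : IsProbabilityMeasure ν := isProbabilityMeasure_restrict_tilted hΩ0 hZ
  set v : ℝ≥0 := ⟨L ^ 2 / lam, by positivity⟩
  have hsg : ∀ p ∈ s, HasSubgaussianMGF (fun x => G p x - ∫ z, G p z ∂ν) v ν := fun p hp =>
    hasSubgaussianMGF_box_of_uniformlyConvexOn hΩo hΩc hΩ0 hlam hVc hV hZ (hG p hp) (hGb p hp) (hGD p hp) hL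
  have h0 := maxTail_of_hasSubgaussianMGF ν s (fun p x => G p x - ∫ z, G p z ∂ν) v hsg ht
  have hexp : 2 * (s.card : ℝ) * Real.exp (-t ^ 2 / (2 * (v : ℝ))) = 2 * s.card * Real.exp (-(lam * t ^ 2 / (2 * L ^ 2))) := by
    rw [show (v : ℝ) = L ^ 2 / lam from rfl]
    congr 2
    field_simp
  exact h0.trans hexp.le

/-- ★ **THE COUPLING CANCELS (box edition)**: fibre action `V = g⁻²·Ψ` with `Ψ` `m`-convex on the box — i.e. `V` `(m∕g²)`-convex on `Ω` — and thresholds `g·t`: the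
max-tail under the box law is `2·#s·exp(−m·t²∕(2L²))`, independent of the coupling `g > 0`. [cite: BobkovLedoux2000, Prop. 3.1 p. 1034; Balaban1985UV3, (38)-(41) p.266] -/
theorem convex_maxTail_box_coupling_cancels (hΩo : IsOpen Ωs) (hΩc : Convex ℝ Ωs) (hΩ0 : volume Ωs ≠ 0) {m g : ℝ} (hm : 0 < m) (hg : 0 < g)
    (hVc : ContinuousOn V Ωs) (hV : ∀ x ∈ Ωs, ∀ y ∈ Ωs, V x + ⟪W x, y - x⟫ + (m / g ^ 2) / 2 * ‖y - x‖ ^ 2 ≤ V y)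
    (hZ : IntegrableOn (fun x => Real.exp (-V x)) Ωs)
    {A : Type*} (s : Finset A) (G : A → EuclideanSpace ℝ (Fin n) → ℝ) (B : A → ℝ) {L : ℝ} (hL : 0 < L)
    (hG : ∀ p ∈ s, ContDiff ℝ 1 (G p)) (hGb : ∀ p ∈ s, ∀ x, |G p x| ≤ B p) (hGD : ∀ p ∈ s, ∀ x, ‖fderiv ℝ (G p) x‖ ≤ L)
    {t : ℝ} (ht : 0 ≤ t) :
    ((volume.restrict Ωs).tilted fun x => -V x).real
        {x | ∃ p ∈ s, g * t ≤ |G p x - ∫ z, G p z ∂((volume.restrict Ωs).tilted fun x => -V x)|} ≤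
      2 * s.card * Real.exp (-(m * t ^ 2 / (2 * L ^ 2))) := by
  have h := convex_maxTail_box hΩo hΩc hΩ0 (div_pos hm (pow_pos hg 2)) hVc hV hZ s G B hL hG hGb hGD (mul_nonneg hg.le ht)
  have hexp : -(m / g ^ 2 * (g * t) ^ 2 / (2 * L ^ 2)) = -(m * t ^ 2 / (2 * L ^ 2)) := by
    field_simp
  rwa [hexp] at h

/-- ★ **CENTRING BY THE WINDOW-EDGE FORCING NUMBER (box edition)**: if moreover every mean is small, `|∫G_p dν_Ω| ≤ g·t∕2` (the one-step minimiser's fine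
plaquettes sit at most half-way to the finer threshold — the card's falsifier (a)), then the UNCENTRED window odds under the box law obey
`ν_Ω.real {x | ∃ p ∈ s, g·t ≤ |G_p x|} ≤ 2·#s·exp(−m·t²∕(8L²))`. [cite: BobkovLedoux2000, Prop. 3.1 p. 1034; Balaban1985Variational, Thm 1 (9)-(10) p.279] -/
theorem convex_maxTail_box_of_centred (hΩo : IsOpen Ωs) (hΩc : Convex ℝ Ωs) (hΩ0 : volume Ωs ≠ 0) {m g : ℝ} (hm : 0 < m) (hg : 0 < g)
    (hVc : ContinuousOn V Ωs) (hV : ∀ x ∈ Ωs, ∀ y ∈ Ωs, V x + ⟪W x, y - x⟫ + (m / g ^ 2) / 2 * ‖y - x‖ ^ 2 ≤ V y)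
    (hZ : IntegrableOn (fun x => Real.exp (-V x)) Ωs)
    {A : Type*} (s : Finset A) (G : A → EuclideanSpace ℝ (Fin n) → ℝ) (B : A → ℝ) {L : ℝ} (hL : 0 < L)
    (hG : ∀ p ∈ s, ContDiff ℝ 1 (G p)) (hGb : ∀ p ∈ s, ∀ x, |G p x| ≤ B p) (hGD : ∀ p ∈ s, ∀ x, ‖fderiv ℝ (G p) x‖ ≤ L)
    {t : ℝ} (ht : 0 ≤ t)
    (hmean : ∀ p ∈ s, |∫ z, G p z ∂((volume.restrict Ωs).tilted fun x => -V x)| ≤ g * t / 2) :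
    ((volume.restrict Ωs).tilted fun x => -V x).real {x | ∃ p ∈ s, g * t ≤ |G p x|} ≤
      2 * s.card * Real.exp (-(m * t ^ 2 / (8 * L ^ 2))) := by
  set ν : Measure (EuclideanSpace ℝ (Fin n)) := (volume.restrict Ωs).tilted fun x => -V x
  haveI : IsProbabilityMeasure ν := isProbabilityMeasure_restrict_tilted hΩ0 hZ
  have hlam : 0 < m / g ^ 2 := div_pos hm (pow_pos hg 2)
  set v : ℝ≥0 := ⟨L ^ 2 / (m / g ^ 2), by positivity⟩
  have hsg : ∀ p ∈ s, HasSubgaussianMGF (fun x => G p x - ∫ z, G p z ∂ν) v ν := fun p hp =>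
    hasSubgaussianMGF_box_of_uniformlyConvexOn hΩo hΩc hΩ0 hlam hVc hV hZ (hG p hp) (hGb p hp) (hGD p hp) hL
  -- `|G| ≥ g t` and `|mean| ≤ g t / 2` force `|G − mean| ≥ g t / 2`; then the generic max-tail ✓`maxTail_of_hasSubgaussianMGF` (F §0)
  have hsub : {x | ∃ p ∈ s, g * t ≤ |G p x|} ⊆ {x | ∃ p ∈ s, g * t / 2 ≤ |G p x - ∫ z, G p z ∂ν|} := by
    rintro x ⟨p, hp, hx⟩
    refine ⟨p, hp, ?_⟩
    have h1 : |G p x| - |∫ z, G p z ∂ν| ≤ |G p x - ∫ z, G p z ∂ν| := abs_sub_abs_le_abs_sub _ _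
    have h2 := hmean p hp
    linarith
  have h0 := (measureReal_mono hsub).trans
    (maxTail_of_hasSubgaussianMGF ν s (fun p x => G p x - ∫ z, G p z ∂ν) v hsg (by positivity : (0 : ℝ) ≤ g * t / 2))
  have hexp : 2 * (s.card : ℝ) * Real.exp (-(g * t / 2) ^ 2 / (2 * (v : ℝ))) = 2 * s.card * Real.exp (-(m * t ^ 2 / (8 * L ^ 2))) := by
    rw [show (v : ℝ) = L ^ 2 / (m / g ^ 2) from rfl]
    congr 2
    field_simp
    ring
  exact h0.trans hexp.le

end Box

/-! ## §3 The conditioned law: whole-space `λ`-convex `V`, conditioned on any convex set of positive volume -/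

section ConvexSet

variable {Bx : Set (EuclideanSpace ℝ (Fin n))} {V : EuclideanSpace ℝ (Fin n) → ℝ} {W : EuclideanSpace ℝ (Fin n) → EuclideanSpace ℝ (Fin n)}
  {lam : ℝ}

/-- ★ **DIMENSION-FREE MAX-TAIL UNDER A LOG-CONCAVE LAW CONDITIONED ON A CONVEX SET**: `V` continuous and `λ`-uniformly convex on the whole space (first-order
letter, any field `W`), `e^{−V}` integrable, `Bx` convex with `volume Bx ≠ 0`: under `ν_B = (volume.restrict Bx).tilted (−V)` — the log-concave law `e^{−V}dx∕Z`
CONDITIONED on `Bx` — the max-tail of bounded `C¹` observables with `‖DG_p‖ ≤ L` about their conditioned means is `≤ 2·#s·exp(−λ·t²∕(2L²))`: «the restriction of a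
log-concave law to a convex set stays log-concave», with the same constant (✓`hasSubgaussianMGF_convexSet_of_uniformlyConvex`: Bobkov–Ledoux p. 1038, PROVED).
[cite: BobkovLedoux2000, remark p. 1038; BakryGentilLedoux2014, Prop. 5.4.1] -/
theorem convex_maxTail_convexSet (hB : Convex ℝ Bx) (hB0 : volume Bx ≠ 0) (hlam : 0 < lam) (hVc : Continuous V)
    (hV : ∀ x y : EuclideanSpace ℝ (Fin n), V x + ⟪W x, y - x⟫ + lam / 2 * ‖y - x‖ ^ 2 ≤ V y)
    (hZ : Integrable fun x => Real.exp (-V x))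
    {A : Type*} (s : Finset A) (G : A → EuclideanSpace ℝ (Fin n) → ℝ) (B : A → ℝ) {L : ℝ} (hL : 0 < L)
    (hG : ∀ p ∈ s, ContDiff ℝ 1 (G p)) (hGb : ∀ p ∈ s, ∀ x, |G p x| ≤ B p) (hGD : ∀ p ∈ s, ∀ x, ‖fderiv ℝ (G p) x‖ ≤ L)
    {t : ℝ} (ht : 0 ≤ t) :
    ((volume.restrict Bx).tilted fun x => -V x).real
        {x | ∃ p ∈ s, t ≤ |G p x - ∫ z, G p z ∂((volume.restrict Bx).tilted fun x => -V x)|} ≤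
      2 * s.card * Real.exp (-(lam * t ^ 2 / (2 * L ^ 2))) := by
  set ν : Measure (EuclideanSpace ℝ (Fin n)) := (volume.restrict Bx).tilted fun x => -V x
  haveI : IsProbabilityMeasure ν := isProbabilityMeasure_restrict_tilted hB0 hZ.integrableOn
  set v : ℝ≥0 := ⟨L ^ 2 / lam, by positivity⟩
  have hsg : ∀ p ∈ s, HasSubgaussianMGF (fun x => G p x - ∫ z, G p z ∂ν) v ν := fun p hp =>
    hasSubgaussianMGF_convexSet_of_uniformlyConvex hB hB0 hlam hVc hV hZ (hG p hp) (hGb p hp) (hGD p hp) hL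
  have h0 := maxTail_of_hasSubgaussianMGF ν s (fun p x => G p x - ∫ z, G p z ∂ν) v hsg ht
  have hexp : 2 * (s.card : ℝ) * Real.exp (-t ^ 2 / (2 * (v : ℝ))) = 2 * s.card * Real.exp (-(lam * t ^ 2 / (2 * L ^ 2))) := by
    rw [show (v : ℝ) = L ^ 2 / lam from rfl]
    congr 2
    field_simp
  exact h0.trans hexp.le

/-- ★ **CENTRED, COUPLING-FREE (conditioned edition)**: `V` `(m∕g²)`-convex on the whole space, conditioned on the convex set `Bx`; thresholds `g·t` and means
`|∫G_p dν_B| ≤ g·t∕2` ⇒ `ν_B.real {x | ∃ p ∈ s, g·t ≤ |G_p x|} ≤ 2·#s·exp(−m·t²∕(8L²))`. [cite: BobkovLedoux2000, remark p. 1038; Balaban1985UV3, (38)-(41) p.266] -/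
theorem convex_maxTail_convexSet_of_centred (hB : Convex ℝ Bx) (hB0 : volume Bx ≠ 0) {m g : ℝ} (hm : 0 < m) (hg : 0 < g) (hVc : Continuous V)
    (hV : ∀ x y : EuclideanSpace ℝ (Fin n), V x + ⟪W x, y - x⟫ + (m / g ^ 2) / 2 * ‖y - x‖ ^ 2 ≤ V y)
    (hZ : Integrable fun x => Real.exp (-V x))
    {A : Type*} (s : Finset A) (G : A → EuclideanSpace ℝ (Fin n) → ℝ) (B : A → ℝ) {L : ℝ} (hL : 0 < L)
    (hG : ∀ p ∈ s, ContDiff ℝ 1 (G p)) (hGb : ∀ p ∈ s, ∀ x, |G p x| ≤ B p) (hGD : ∀ p ∈ s, ∀ x, ‖fderiv ℝ (G p) x‖ ≤ L)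
    {t : ℝ} (ht : 0 ≤ t)
    (hmean : ∀ p ∈ s, |∫ z, G p z ∂((volume.restrict Bx).tilted fun x => -V x)| ≤ g * t / 2) :
    ((volume.restrict Bx).tilted fun x => -V x).real {x | ∃ p ∈ s, g * t ≤ |G p x|} ≤
      2 * s.card * Real.exp (-(m * t ^ 2 / (8 * L ^ 2))) := by
  set ν : Measure (EuclideanSpace ℝ (Fin n)) := (volume.restrict Bx).tilted fun x => -V x
  haveI : IsProbabilityMeasure ν := isProbabilityMeasure_restrict_tilted hB0 hZ.integrableOn
  have hlam : 0 < m / g ^ 2 := div_pos hm (pow_pos hg 2)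
  set v : ℝ≥0 := ⟨L ^ 2 / (m / g ^ 2), by positivity⟩
  have hsg : ∀ p ∈ s, HasSubgaussianMGF (fun x => G p x - ∫ z, G p z ∂ν) v ν := fun p hp =>
    hasSubgaussianMGF_convexSet_of_uniformlyConvex hB hB0 hlam hVc hV hZ (hG p hp) (hGb p hp) (hGD p hp) hL
  -- `|G| ≥ g t` and `|mean| ≤ g t / 2` force `|G − mean| ≥ g t / 2`; then the generic max-tail ✓`maxTail_of_hasSubgaussianMGF` (F §0)
  have hsub : {x | ∃ p ∈ s, g * t ≤ |G p x|} ⊆ {x | ∃ p ∈ s, g * t / 2 ≤ |G p x - ∫ z, G p z ∂ν|} := by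
    rintro x ⟨p, hp, hx⟩
    refine ⟨p, hp, ?_⟩
    have h1 : |G p x| - |∫ z, G p z ∂ν| ≤ |G p x - ∫ z, G p z ∂ν| := abs_sub_abs_le_abs_sub _ _
    have h2 := hmean p hp
    linarith
  have h0 := (measureReal_mono hsub).trans
    (maxTail_of_hasSubgaussianMGF ν s (fun p x => G p x - ∫ z, G p z ∂ν) v hsg (by positivity : (0 : ℝ) ≤ g * t / 2))
  have hexp : 2 * (s.card : ℝ) * Real.exp (-(g * t / 2) ^ 2 / (2 * (v : ℝ))) = 2 * s.card * Real.exp (-(m * t ^ 2 / (8 * L ^ 2))) := by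
    rw [show (v : ℝ) = L ^ 2 / (m / g ^ 2) from rfl]
    congr 2
    field_simp
    ring
  exact h0.trans hexp.le

end ConvexSet

/-! ## §4 In the tree's profile: thresholds `θBal L γ b₀ p₀ i = g_i·p(g_i)`; the modulus is the Gaussian file's, by name -/

section Profile

variable {V : EuclideanSpace ℝ (Fin n) → ℝ} {W : EuclideanSpace ℝ (Fin n) → EuclideanSpace ℝ (Fin n)}

/-- `0 < g_i = √(γL^{−i})` and `0 ≤ pFun b₀ p₀ g_i` for `0 < γ ≤ 1`, `1 ≤ L_fam`, `0 ≤ b₀` (then `g_i ≤ 1`, so `1 + log g_i⁻¹ ≥ 1`). [folklore] -/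
theorem coupling_pos_and_pFun_nonneg {Lfam : ℕ} (hLfam : 1 ≤ Lfam) {γ b₀ : ℝ} (hγ : 0 < γ) (hγ1 : γ ≤ 1) (hb₀ : 0 ≤ b₀) (p₀ : ℝ) (i : ℕ) :
    0 < Real.sqrt (γ * ((Lfam : ℝ)⁻¹) ^ i) ∧ 0 ≤ B10.pFun b₀ p₀ (Real.sqrt (γ * ((Lfam : ℝ)⁻¹) ^ i)) := by
  have hLpos : (0 : ℝ) < Lfam := by exact_mod_cast hLfam
  have hg : 0 < Real.sqrt (γ * ((Lfam : ℝ)⁻¹) ^ i) := Real.sqrt_pos.mpr (mul_pos hγ (pow_pos (inv_pos.mpr hLpos) i))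
  have hLinv : ((Lfam : ℝ)⁻¹) ^ i ≤ 1 := pow_le_one₀ (inv_nonneg.mpr hLpos.le) (inv_le_one_of_one_le₀ (by exact_mod_cast hLfam))
  have hg1 : Real.sqrt (γ * ((Lfam : ℝ)⁻¹) ^ i) ≤ 1 := by
    rw [← Real.sqrt_one]
    exact Real.sqrt_le_sqrt (by nlinarith [pow_nonneg (inv_nonneg.mpr hLpos.le) i])
  refine ⟨hg, ?_⟩
  unfold B10.pFun
  refine mul_nonneg hb₀ (Real.rpow_nonneg ?_ _)
  have hlog : 0 ≤ Real.log (Real.sqrt (γ * ((Lfam : ℝ)⁻¹) ^ i))⁻¹ := Real.log_nonneg ((one_le_inv₀ hg).mpr hg1)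
  linarith

/-- ★ **BOX-LAW WINDOW ODDS AT LEVEL `i`**: fibre action `(m∕g_i²)`-uniformly convex on the open convex chart domain `Ω` (`volume Ω ≠ 0`), `g_i = √(γL^{−i})`,
plaquette observables `C¹` with chart-gradient `≤ L` and box-law means `≤ θ_i∕2`: the odds under `ν_Ω` that some observable leaves the level-`i` window
`θBal L γ b₀ p₀ i` are `≤ 2·#s·exp(−(m∕4)·pFun b₀ p₀ g_i²∕(2L²))` — the shape of ✓`…TailSupOneGaussianTail.gaussianWindowOdds_le` at `m ↦ m∕4`, `R² ↦ L²`, so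
✓`gaussianWindowOdds_levelSum_le` ∕ ✓`gaussianWindowOdds_superpoly` give the level sums `≤ A'·2^{−J}` and TAILSUP's super-polynomial clause BY NAME.
[cite: Balaban1985UV3, (7) p.257 and (38)-(41) p.266; BobkovLedoux2000, Prop. 3.1 p. 1034] -/
theorem convexWindowOdds_box_le {Ωs : Set (EuclideanSpace ℝ (Fin n))} (hΩo : IsOpen Ωs) (hΩc : Convex ℝ Ωs) (hΩ0 : volume Ωs ≠ 0)
    {m : ℝ} (hm : 0 < m) {Lfam : ℕ} (hLfam : 1 ≤ Lfam) {γ b₀ : ℝ} (hγ : 0 < γ) (hγ1 : γ ≤ 1) (hb₀ : 0 ≤ b₀) (p₀ : ℝ) (i : ℕ)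
    (hVc : ContinuousOn V Ωs)
    (hV : ∀ x ∈ Ωs, ∀ y ∈ Ωs, V x + ⟪W x, y - x⟫ + (m / (Real.sqrt (γ * ((Lfam : ℝ)⁻¹) ^ i)) ^ 2) / 2 * ‖y - x‖ ^ 2 ≤ V y)
    (hZ : IntegrableOn (fun x => Real.exp (-V x)) Ωs)
    {A : Type*} (s : Finset A) (G : A → EuclideanSpace ℝ (Fin n) → ℝ) (B : A → ℝ) {L : ℝ} (hL : 0 < L)
    (hG : ∀ p ∈ s, ContDiff ℝ 1 (G p)) (hGb : ∀ p ∈ s, ∀ x, |G p x| ≤ B p) (hGD : ∀ p ∈ s, ∀ x, ‖fderiv ℝ (G p) x‖ ≤ L)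
    (hmean : ∀ p ∈ s, |∫ z, G p z ∂((volume.restrict Ωs).tilted fun x => -V x)| ≤ θBal Lfam γ b₀ p₀ i / 2) :
    ((volume.restrict Ωs).tilted fun x => -V x).real {x | ∃ p ∈ s, θBal Lfam γ b₀ p₀ i ≤ |G p x|} ≤
      2 * s.card * Real.exp (-(m / 4 * B10.pFun b₀ p₀ (Real.sqrt (γ * ((Lfam : ℝ)⁻¹) ^ i)) ^ 2 / (2 * L ^ 2))) := by
  obtain ⟨hg, hp⟩ := coupling_pos_and_pFun_nonneg hLfam hγ hγ1 hb₀ p₀ i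
  have hmean' : ∀ p ∈ s, |∫ z, G p z ∂((volume.restrict Ωs).tilted fun x => -V x)| ≤
      Real.sqrt (γ * ((Lfam : ℝ)⁻¹) ^ i) * B10.pFun b₀ p₀ (Real.sqrt (γ * ((Lfam : ℝ)⁻¹) ^ i)) / 2 := hmean
  have h := convex_maxTail_box_of_centred hΩo hΩc hΩ0 hm hg hVc hV hZ s G B hL hG hGb hGD hp hmean'
  have hexp : -(m * B10.pFun b₀ p₀ (Real.sqrt (γ * ((Lfam : ℝ)⁻¹) ^ i)) ^ 2 / (8 * L ^ 2)) =
      -(m / 4 * B10.pFun b₀ p₀ (Real.sqrt (γ * ((Lfam : ℝ)⁻¹) ^ i)) ^ 2 / (2 * L ^ 2)) := by ring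
  rw [hexp] at h
  exact h

/-- ★ **CONDITIONED-LAW WINDOW ODDS AT LEVEL `i`**: the same bound for a whole-space `(m∕g_i²)`-convex fibre action conditioned on a convex set `Bx` of positive
volume (the `{all fine plaquettes < δ₀}`-restriction when that region is convex in the chart). [cite: Balaban1985UV3, (7) p.257 and (38)-(41) p.266;
BobkovLedoux2000, remark p. 1038] -/
theorem convexWindowOdds_convexSet_le {Bx : Set (EuclideanSpace ℝ (Fin n))} (hB : Convex ℝ Bx) (hB0 : volume Bx ≠ 0)
    {m : ℝ} (hm : 0 < m) {Lfam : ℕ} (hLfam : 1 ≤ Lfam) {γ b₀ : ℝ} (hγ : 0 < γ) (hγ1 : γ ≤ 1) (hb₀ : 0 ≤ b₀) (p₀ : ℝ) (i : ℕ)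
    (hVc : Continuous V)
    (hV : ∀ x y : EuclideanSpace ℝ (Fin n), V x + ⟪W x, y - x⟫ + (m / (Real.sqrt (γ * ((Lfam : ℝ)⁻¹) ^ i)) ^ 2) / 2 * ‖y - x‖ ^ 2 ≤ V y)
    (hZ : Integrable fun x => Real.exp (-V x))
    {A : Type*} (s : Finset A) (G : A → EuclideanSpace ℝ (Fin n) → ℝ) (B : A → ℝ) {L : ℝ} (hL : 0 < L)
    (hG : ∀ p ∈ s, ContDiff ℝ 1 (G p)) (hGb : ∀ p ∈ s, ∀ x, |G p x| ≤ B p) (hGD : ∀ p ∈ s, ∀ x, ‖fderiv ℝ (G p) x‖ ≤ L)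
    (hmean : ∀ p ∈ s, |∫ z, G p z ∂((volume.restrict Bx).tilted fun x => -V x)| ≤ θBal Lfam γ b₀ p₀ i / 2) :
    ((volume.restrict Bx).tilted fun x => -V x).real {x | ∃ p ∈ s, θBal Lfam γ b₀ p₀ i ≤ |G p x|} ≤
      2 * s.card * Real.exp (-(m / 4 * B10.pFun b₀ p₀ (Real.sqrt (γ * ((Lfam : ℝ)⁻¹) ^ i)) ^ 2 / (2 * L ^ 2))) := by
  obtain ⟨hg, hp⟩ := coupling_pos_and_pFun_nonneg hLfam hγ hγ1 hb₀ p₀ i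
  have hmean' : ∀ p ∈ s, |∫ z, G p z ∂((volume.restrict Bx).tilted fun x => -V x)| ≤
      Real.sqrt (γ * ((Lfam : ℝ)⁻¹) ^ i) * B10.pFun b₀ p₀ (Real.sqrt (γ * ((Lfam : ℝ)⁻¹) ^ i)) / 2 := hmean
  have h := convex_maxTail_convexSet_of_centred hB hB0 hm hg hVc hV hZ s G B hL hG hGb hGD hp hmean'
  have hexp : -(m * B10.pFun b₀ p₀ (Real.sqrt (γ * ((Lfam : ℝ)⁻¹) ^ i)) ^ 2 / (8 * L ^ 2)) =
      -(m / 4 * B10.pFun b₀ p₀ (Real.sqrt (γ * ((Lfam : ℝ)⁻¹) ^ i)) ^ 2 / (2 * L ^ 2)) := by ring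
  rw [hexp] at h
  exact h

end Profile

/-! ## §5 Mathlib's `StrongConvexOn` currency (no differentiability of the action) -/

section StrongConvex

variable {Ωs : Set (EuclideanSpace ℝ (Fin n))} {V : EuclideanSpace ℝ (Fin n) → ℝ}

/-- ★ **BOX-LAW MAX-TAIL FROM `StrongConvexOn`**: `Ω` open convex with `volume Ω ≠ 0`, `V` continuous on `Ω` with `StrongConvexOn Ω λ V` (`λ > 0`; no
differentiability — the first-order field is a strong-subgradient selection, ✓`exists_firstOrderOn_field_of_strongConvexOn`), `e^{−V}` integrable on `Ω`, bounded
`C¹` observables with `‖DG_p‖ ≤ L`: under `(volume.restrict Ω).tilted (−V)` the max-tail about the means is `≤ 2·#s·exp(−λ·t²∕(2L²))`.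
[cite: BobkovLedoux2000, Prop. 3.1 p. 1034; BakryGentilLedoux2014, Prop. 5.4.1] -/
theorem convex_maxTail_box_of_strongConvexOn (hΩo : IsOpen Ωs) (hΩc : Convex ℝ Ωs) (hΩ0 : volume Ωs ≠ 0) {lam : ℝ} (hlam : 0 < lam)
    (hVs : StrongConvexOn Ωs lam V) (hVc : ContinuousOn V Ωs) (hZ : IntegrableOn (fun x => Real.exp (-V x)) Ωs)
    {A : Type*} (s : Finset A) (G : A → EuclideanSpace ℝ (Fin n) → ℝ) (B : A → ℝ) {L : ℝ} (hL : 0 < L)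
    (hG : ∀ p ∈ s, ContDiff ℝ 1 (G p)) (hGb : ∀ p ∈ s, ∀ x, |G p x| ≤ B p) (hGD : ∀ p ∈ s, ∀ x, ‖fderiv ℝ (G p) x‖ ≤ L)
    {t : ℝ} (ht : 0 ≤ t) :
    ((volume.restrict Ωs).tilted fun x => -V x).real
        {x | ∃ p ∈ s, t ≤ |G p x - ∫ z, G p z ∂((volume.restrict Ωs).tilted fun x => -V x)|} ≤
      2 * s.card * Real.exp (-(lam * t ^ 2 / (2 * L ^ 2))) := by
  obtain ⟨W, hW⟩ := exists_firstOrderOn_field_of_strongConvexOn hVs hΩo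
  exact convex_maxTail_box (W := W) hΩo hΩc hΩ0 hlam hVc hW hZ s G B hL hG hGb hGD ht

/-- ★ **BOX-LAW WINDOW ODDS AT LEVEL `i` FROM `StrongConvexOn`**: as `convexWindowOdds_box_le`, with `StrongConvexOn Ω (m∕g_i²) V` + `ContinuousOn V Ω` in place of
the first-order letter: `≤ 2·#s·exp(−(m∕4)·pFun b₀ p₀ g_i²∕(2L²))`. [cite: Balaban1985UV3, (7) p.257 and (38)-(41) p.266; BobkovLedoux2000, Prop. 3.1 p. 1034] -/
theorem convexWindowOdds_box_le_of_strongConvexOn (hΩo : IsOpen Ωs) (hΩc : Convex ℝ Ωs) (hΩ0 : volume Ωs ≠ 0)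
    {m : ℝ} (hm : 0 < m) {Lfam : ℕ} (hLfam : 1 ≤ Lfam) {γ b₀ : ℝ} (hγ : 0 < γ) (hγ1 : γ ≤ 1) (hb₀ : 0 ≤ b₀) (p₀ : ℝ) (i : ℕ)
    (hVs : StrongConvexOn Ωs (m / (Real.sqrt (γ * ((Lfam : ℝ)⁻¹) ^ i)) ^ 2) V) (hVc : ContinuousOn V Ωs)
    (hZ : IntegrableOn (fun x => Real.exp (-V x)) Ωs)
    {A : Type*} (s : Finset A) (G : A → EuclideanSpace ℝ (Fin n) → ℝ) (B : A → ℝ) {L : ℝ} (hL : 0 < L)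
    (hG : ∀ p ∈ s, ContDiff ℝ 1 (G p)) (hGb : ∀ p ∈ s, ∀ x, |G p x| ≤ B p) (hGD : ∀ p ∈ s, ∀ x, ‖fderiv ℝ (G p) x‖ ≤ L)
    (hmean : ∀ p ∈ s, |∫ z, G p z ∂((volume.restrict Ωs).tilted fun x => -V x)| ≤ θBal Lfam γ b₀ p₀ i / 2) :
    ((volume.restrict Ωs).tilted fun x => -V x).real {x | ∃ p ∈ s, θBal Lfam γ b₀ p₀ i ≤ |G p x|} ≤
      2 * s.card * Real.exp (-(m / 4 * B10.pFun b₀ p₀ (Real.sqrt (γ * ((Lfam : ℝ)⁻¹) ^ i)) ^ 2 / (2 * L ^ 2))) := by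
  obtain ⟨W, hW⟩ := exists_firstOrderOn_field_of_strongConvexOn hVs hΩo
  exact convexWindowOdds_box_le (W := W) hΩo hΩc hΩ0 hm hLfam hγ hγ1 hb₀ p₀ i hVc hW hZ s G B hL hG hGb hGD hmean

end StrongConvex

end Summit.QuantumFields.YangMills.Theorems.FluctuationComparisonRegPrIntLTailSupOneConvexTailBox

end
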